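import Summits.ABC.IUTFork.Cor312StatementBridge
import Summits.ABC.IUTFork.Cor312StatementBridgeChecks
import HarnessLib

/-!
# [IUTchIII] Corollary 3.12 — the log-Kummer (estimate) route to the inequality: volume transport (TEAM B, B-1)

Record-only file (D-0012) of the abc-iut cell (Cor. 3.12 strategy TEAM B «estimate / log-Kummer» of HUMAN
RULING D-0067 (3), row B-1 of `HOME/plan/C312-TEAMS.md`, seat abc-iut-c312-11); TAKES NO SIDE. Team B routes
the printed inequality of [IUTchIII] Cor. 3.12 (kurims `paper:url-4b091feeb646`, pp. 173–174) through the
log-Kummer correspondence of Thm. 3.11 (ii) and the Θ×μ_LGP-link, NEVER through a set-theoretic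
identification of the two pilot regions: the proof's Step (xi-g) (p. 184 l. 30–34) speaks of "two
tautologically equivalent ways to compute the log-volume of the `q`-pilot object at `(1,0)`" — a statement
about LOG-VOLUMES, not about regions. This file types that route over c312-7's verbatim setting
(`Cor312.Setting`, `Statement`) and c312-6's bridge hypotheses (`Cor312Vol.BridgeHyps`), and isolates exactly
what remains:

* `thetaRegion_subset_thetaHull` — every single Kummer image `thetaRegion m` of the Θ-pilot object (the
  `(n,m)`-transport of Thm. 3.11 (ii), whose variation in `m` is (Ind3)) lies in the packet hull
  `^{n,∘}𝒰_{j,v_ℚ}` of the union of the possible images. PROVED (it is the identity-indeterminacy member of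
  the union; proof of Cor. 3.12 p. 174 l. 50 – p. 175 l. 1).
* `ThetaRegionsAdm` — the Kummer images are admissible regions of Thm. 3.11 (i) (a) (in the intended model
  they are hull-set-like regions: [IUTchIII] Prop. 3.9 (i)–(ii), Rmk. 3.9.5 (ix) (cQ3)). HYPOTHESIS, for the
  real instances a discharge item of row B-3.
* `VolumeTransport` — **THE B-INPUT**: for every packet `(j = i+1, v_ℚ)` there is a lattice position `m ∈ ℤ`
  with `−|log(q)|`-contribution `≤` the log-volume of the `m`-th Kummer image of the Θ-pilot object. This is
  the `≤`-form (upper bounds suffice throughout — (Ind3) is "upper semi-compatible", Thm. 3.11 (ii) p. 156)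
  of Step (xi-g)'s "two … ways to compute the log-volume of the `q`-pilot object": the q-pilot computation at
  `(1,0)` equals, through the Θ×μ_LGP-link gluing of Step (xi-a) (p. 181 l. 33–44) and the log-volume
  compatibility of the Kummer isomorphisms (Thm. 3.11 (ii), final clause, p. 156), SOME Kummer-image
  computation on the Θ-side. HYPOTHESIS — never asserted; its derivability from the typed Thm. 3.11 + the
  frozen FACT LIST is exactly what TEAM B adjudicates (plan/GAP-LEDGER.md row if underivable).
* `statement_of_volumeTransport` — **THE ROUTE, PROVED**: `BridgeHyps` ∧ `ThetaRegionsAdm` ∧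
  `VolumeTransport` ⟹ the printed `Statement` (`−|log(Θ)| ∈ ℝ` and `−|log(Θ)| ≥ −|log(q)|`). The engine is
  pure measure bookkeeping: monotonicity of the mono-analytic log-volume on admissible regions
  (`BridgeHyps.mono`, Prop. 3.9 (i)) against the packet hulls, then `∑ᶠ` over `v_ℚ` (Prop. 3.9 (iii)) and the
  procession-normalized average over `j ∈ 𝔽_l^⋇` (Prop. 3.9 (i); Cor. 3.12 p. 173 l. 44). NO containment of
  the `q`-pilot region in the Θ-side hull is used anywhere — compare readings R2/R3
  (`statement_of_qRegion_subset_thetaHull` / `…_mem_possibleImages`, c312-6): this route replaces the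
  set-level hypotheses by the volume-level one, which is weaker than R2 at every admissible `q`-region
  (`volumeTransport_of_qRegion_subset_thetaRegion`) and incomparable with R1.
* `LinkGluing` / `LinkGluing.TwoWays` / `statement_of_linkGluing` — the B-INPUT decomposed along the print:
  a value-group-portion map on objects carrying the Θ-pilot to the `q`-pilot ((xi-a): "the Θ-pilot object at
  `(0,0)` corresponds to the `q`-pilot at `(1,0)`" under the gluing; L6-t4 `thetaLGPLink` is the full
  poly-isomorphism it rides) together with the per-object two-ways volume comparison ((xi-g)). PROVED:
  `TwoWays` at the Θ-pilot object gives `VolumeTransport`, hence `Statement`.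
* Non-vacuity: all hypotheses hold on c312-6's nonempty toy (`volumeTransport_toySettingNE`,
  `linkGluingToy`, `example`s), so the route runs end to end; and the B-INPUT has content
  (`not_volumeTransport_of_not_statement`: wherever the Statement fails under `BridgeHyps` +
  `ThetaRegionsAdm`, `VolumeTransport` fails too — it is not a free hypothesis).

Sources read on the page: [IUTchIII] pp. 173–175 (statement, opening of the proof), p. 156 (Thm. 3.11 (ii)
(Ind3) + final clause), p. 181 l. 33–44 (xi-a), pp. 183–184 ((xi-d)–(xi-g)); [IUTchIV] p. 27 Step (v)
("(Ind3) is taken into account by the fact that we are considering upper bounds"). Nothing here asserts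
Cor. 3.12 or any of the hypotheses; typed ≠ proved; no side taken. [claim: Mochizuki2012, status: disputed]
Deliberately NOT here: the construction of the glue maps (c312-7 residuals R1/R2; c312-1 C/G), the real
discharges of `ThetaRegionsAdm` (row B-3) and of the bridge hypotheses (team A row A-0), any judgement.
-/

noncomputable section

namespace Summit.ABC

namespace IUTFork

namespace Cor312Vol

open Thm311 Cor312 Literature.IUT.LogThetaLattice

variable {T : ThetaIndex} {S : Situation T} (P : Cor312.Setting S)

/-! ## 1. Each single Kummer image lies in the packet hull -/

/-- Every single Kummer image `thetaRegion m` of the Θ-pilot object lies in the packet hull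
`^{n,∘}𝒰_{j,v_ℚ}` of the union of the possible images: it is contained in the (Ind3)-enlarged region
(`⋃ₘ`), which is the identity-(Ind1)(Ind2) member of the union (proof of Cor. 3.12, p. 174 l. 50 –
p. 175 l. 1). [folklore] -/
theorem thetaRegion_subset_thetaHull (m : ℤ) (j : T.Label) (vQ : T.VQ) :
    P.thetaRegion m j vQ ⊆ P.thetaHull j vQ :=
  ((Set.subset_iUnion (fun m' : ℤ => P.thetaRegion m' j vQ) m).trans
    (Set.subset_sUnion_of_mem (P.thetaRegion3_mem_possibleImages j vQ))).trans
    ((P.frame j vQ).subset_hull _)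

/-! ## 2. The two hypotheses of the route -/

/-- **Admissibility of the Kummer images**: each `(n,m)`-Kummer image of the Θ-pilot object, at the labels
`j ∈ 𝔽_l^⋇`, is an admissible region of Thm. 3.11 (i) (a) (in the intended model the pilot regions are
hull-set-like regions carrying a log-volume: [IUTchIII] Prop. 3.9 (i)–(ii), Rmk. 3.9.5 (ix); discharge over
the real instances = plan/C312-TEAMS.md row B-3). HYPOTHESIS. [claim: Mochizuki2012, status: disputed] -/
@[claim "Mochizuki2012" "disputed"] def ThetaRegionsAdm : Prop :=
  ∀ (m : ℤ) (i : Fin T.lstar) (vQ : T.VQ),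
    (S.D P.n).Adm (Setting.labelSucc i) vQ (P.thetaRegion m (Setting.labelSucc i) vQ)

/-- **VOLUME TRANSPORT — the B-INPUT of the log-Kummer route** ([IUTchIII] Cor. 3.12, Step (xi-g) p. 184
l. 30–34: "two tautologically equivalent ways to compute the log-volume of the `q`-pilot object at `(1,0)`",
through the Θ×μ_LGP-link gluing of (xi-a) and the log-volume compatibility of the Kummer isomorphisms,
Thm. 3.11 (ii) final clause p. 156; stated with `≤`, the direction the estimate needs — upper bounds
suffice, [IUTchIV] p. 27 Step (v)): in every packet `(j = i+1, v_ℚ)` the `q`-pilot contribution to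
`−|log(q)|` is at most the log-volume of SOME single Kummer image of the Θ-pilot object. HYPOTHESIS —
whether it follows from the typed Thm. 3.11 + the frozen FACT LIST is Team B's adjudication target; never
asserted here. [claim: Mochizuki2012, status: disputed] -/
@[claim "Mochizuki2012" "disputed"] def VolumeTransport : Prop :=
  ∀ (i : Fin T.lstar) (vQ : T.VQ), ∃ m : ℤ,
    P.qLocal (Setting.labelSucc i) vQ ≤
      (S.D P.n).logvol (Setting.labelSucc i) vQ (P.thetaRegion m (Setting.labelSucc i) vQ)

/-- The UNIFORM (single lattice position) form: one `m ∈ ℤ` — in the print, the gluing position — works in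
every packet. [claim: Mochizuki2012, status: disputed] -/
@[claim "Mochizuki2012" "disputed"] def VolumeTransportAt (m : ℤ) : Prop :=
  ∀ (i : Fin T.lstar) (vQ : T.VQ),
    P.qLocal (Setting.labelSucc i) vQ ≤
      (S.D P.n).logvol (Setting.labelSucc i) vQ (P.thetaRegion m (Setting.labelSucc i) vQ)

variable {P}

/-- The uniform form implies the pointwise form. [folklore] -/
theorem volumeTransport_of_at {m : ℤ} (h : VolumeTransportAt P m) : VolumeTransport P :=
  fun i vQ => ⟨m, h i vQ⟩

/-- READING R2 at the level of a SINGLE Kummer image implies volume transport: if the `q`-pilot region is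
contained in some `thetaRegion m` (with both admissible), monotonicity gives the volume comparison — the
route strictly weakens the set-level reading to a volume-level one. [folklore] -/
theorem volumeTransport_of_qRegion_subset_thetaRegion (hmono : LogvolMono P)
    (hadm : ThetaRegionsAdm P)
    (hq : ∀ (i : Fin T.lstar) (vQ : T.VQ),
      (S.D P.n).Adm (Setting.labelSucc i) vQ (P.qRegion (Setting.labelSucc i) vQ))
    (h : ∀ (i : Fin T.lstar) (vQ : T.VQ), ∃ m : ℤ,
      P.qRegion (Setting.labelSucc i) vQ ⊆ P.thetaRegion m (Setting.labelSucc i) vQ) :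
    VolumeTransport P := by
  intro i vQ
  obtain ⟨m, hm⟩ := h i vQ
  exact ⟨m, hmono i vQ (hq i vQ) (hadm m i vQ) hm⟩

/-! ## 3. The route: pointwise, then summed, then averaged -/

/-- Pointwise estimate: under the bridge hypotheses, admissibility of the Kummer images and volume
transport, the `q`-pilot contribution at `(j, v_ℚ)` is at most the hull contribution `thetaLocal` (read as a
real number — `ThetaFinite` makes the hull defined). Chain: volume transport → monotonicity into the packet
hull (`thetaRegion_subset_thetaHull`). [folklore] -/
theorem qLocal_le_thetaLocal_untopD (H : BridgeHyps P) (hadm : ThetaRegionsAdm P)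
    (hvt : VolumeTransport P) (i : Fin T.lstar) (vQ : T.VQ) :
    P.qLocal (Setting.labelSucc i) vQ ≤ (P.thetaLocal (Setting.labelSucc i) vQ).untopD 0 := by
  obtain ⟨m, hm⟩ := hvt i vQ
  rw [thetaLocal_untopD H]
  exact hm.trans (H.mono i vQ (hadm m i vQ)
    (P.thetaHull_adm (hullDefined_of_finite H i vQ)) (thetaRegion_subset_thetaHull P m _ vQ))

/-- The `q`-pilot log-volumes are finitely supported over `v_ℚ` at each label (`Setting.qSupport_finite`,
[IUTchIII] Prop. 3.9 (iii)), read on `qLocal`. [folklore] -/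
theorem qLocal_support_finite (j : T.Label) :
    (Function.support fun vQ => P.qLocal j vQ).Finite :=
  P.qSupport_finite j

/-- Monotonicity of the procession-normalized average ([IUTchIII] Prop. 3.9 (i): an average of `l^⋇` terms
with equal weights; Rmk. 3.9.3). [folklore] -/
theorem processionNormalized_mono {lstar : ℕ} {f g : Fin lstar → ℝ} (h : ∀ i, f i ≤ g i) :
    processionNormalized f ≤ processionNormalized g := by
  unfold processionNormalized
  rw [div_eq_mul_inv, div_eq_mul_inv]
  exact mul_le_mul_of_nonneg_right (Finset.sum_le_sum fun j _ => h j) (by positivity)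

variable (P) in
/-- **THE LOG-KUMMER ROUTE TO THE INEQUALITY, PROVED**: under the bridge hypotheses (`BridgeHyps`,
including the Corollary's own "`−|log(Θ)| ∈ ℝ`" = `ThetaFinite`), admissibility of the Kummer images
(`ThetaRegionsAdm`) and VOLUME TRANSPORT (the B-INPUT), the printed Statement of Cor. 3.12 holds:
`−|log(Θ)| ∈ ℝ` and `−|log(q)| ≤ −|log(Θ)|`. The proof never compares the two pilot REGIONS — only their
log-volumes, per packet, then summed over `v_ℚ` (Prop. 3.9 (iii)) and averaged over `j ∈ 𝔽_l^⋇`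
(Prop. 3.9 (i)). Every hypothesis is named; nothing is asserted. [claim: Mochizuki2012, status: disputed] -/
theorem statement_of_volumeTransport (H : BridgeHyps P) (hadm : ThetaRegionsAdm P)
    (hvt : VolumeTransport P) : P.Statement := by
  constructor
  · unfold Setting.negLogTheta
    rw [if_pos H.finite]
    exact WithTop.coe_ne_top
  · unfold Setting.negLogTheta
    rw [if_pos H.finite, WithTop.coe_le_coe]
    unfold Setting.negLogQ
    refine processionNormalized_mono fun i => ?_
    exact finsum_le_finsum' (qLocal_support_finite _) (H.finite.2 i)
      fun vQ => qLocal_le_thetaLocal_untopD H hadm hvt i vQ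

/-- The B-INPUT is not free: wherever the Statement fails (under the bridge hypotheses and admissible
Kummer images), volume transport fails too. [folklore] -/
theorem not_volumeTransport_of_not_statement (H : BridgeHyps P) (hadm : ThetaRegionsAdm P)
    (h : ¬ P.Statement) : ¬ VolumeTransport P :=
  fun hvt => h (statement_of_volumeTransport P H hadm hvt)

/-! ## 4. The B-INPUT decomposed along the print: the link gluing and the two-ways comparison -/

variable (P) in
/-- **The Θ×μ_LGP-link gluing on objects** (Step (xi-a), p. 181 l. 33–44: "the `q`-pilot object at `(1,0)`
… the [Θ×μ_LGP-]link … as a gluing under which the Θ-pilot object at `(0,0)` corresponds to the `q`-pilot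
object at `(1,0)`"; the full poly-isomorphism it rides is L6-t4's `thetaLGPLink`, cf. c312-8
`Cor312Rmk.bitw_link_eq_univ`): a value-group-portion map from objects of `†𝒞^⊩_lgp` to objects of
`†𝒞^⊩_△` carrying the Θ-pilot object to the `q`-pilot object. DATA (which map the print intends is part of
the dispute; nothing is asserted about it here). [claim: Mochizuki2012, status: disputed] -/
structure LinkGluing : Type where
  /-- the value-group portion of the link on objects -/
  linkMap : P.Ob P.sig.Clgp → P.ObΔ
  /-- (xi-a): the Θ-pilot object corresponds to the `q`-pilot object under the gluing -/
  link_thetaPilot : linkMap P.thetaPilot = P.qPilot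

namespace LinkGluing

variable (G : LinkGluing P)

/-- **The two-ways volume comparison** (Step (xi-g), p. 184 l. 30–34, per object; `≤`-form): for every
object `o` of `†𝒞^⊩_lgp` and every packet, the log-volume of the `q`-side region of its gluing image is at
most the log-volume of SOME `(n,m)`-Kummer image of `o` — "two tautologically equivalent ways to compute
the log-volume" with the equality relaxed to the direction the estimate uses. HYPOTHESIS.
[claim: Mochizuki2012, status: disputed] -/
@[claim "Mochizuki2012" "disputed"] def TwoWays : Prop :=
  ∀ (o : P.Ob P.sig.Clgp) (i : Fin T.lstar) (vQ : T.VQ), ∃ m : ℤ,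
    (S.D P.n).logvol (Setting.labelSucc i) vQ (P.qRegionOf (G.linkMap o) (Setting.labelSucc i) vQ) ≤
      (S.D P.n).logvol (Setting.labelSucc i) vQ (P.thetaRegionOf m o (Setting.labelSucc i) vQ)

/-- The two-ways comparison AT the Θ-pilot object gives volume transport (rewrite along (xi-a)).
[folklore] -/
theorem volumeTransport_of_twoWays (h : G.TwoWays) : VolumeTransport P := by
  intro i vQ
  obtain ⟨m, hm⟩ := h P.thetaPilot i vQ
  refine ⟨m, ?_⟩
  calc P.qLocal (Setting.labelSucc i) vQ
      = (S.D P.n).logvol (Setting.labelSucc i) vQ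
          (P.qRegionOf (G.linkMap P.thetaPilot) (Setting.labelSucc i) vQ) := by
        rw [G.link_thetaPilot]; rfl
    _ ≤ (S.D P.n).logvol (Setting.labelSucc i) vQ
          (P.thetaRegionOf m P.thetaPilot (Setting.labelSucc i) vQ) := hm
    _ = (S.D P.n).logvol (Setting.labelSucc i) vQ
          (P.thetaRegion m (Setting.labelSucc i) vQ) := rfl

end LinkGluing

variable (P) in
/-- **The decomposed route**: bridge hypotheses + admissible Kummer images + a link gluing ((xi-a)) with
the two-ways volume comparison ((xi-g)) ⟹ the printed Statement. The two structure fields are exactly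
where the three printed positions disagree; both are named hypotheses, neither is asserted.
[claim: Mochizuki2012, status: disputed] -/
theorem statement_of_linkGluing (H : BridgeHyps P) (hadm : ThetaRegionsAdm P) (G : LinkGluing P)
    (h2 : G.TwoWays) : P.Statement :=
  statement_of_volumeTransport P H hadm (G.volumeTransport_of_twoWays h2)

/-! ## 5. Non-vacuity on the nonempty toy (c312-6's `toySettingNE`: all log-volumes `0`) -/

namespace Checks

/-- The Kummer images of the nonempty toy are admissible (everything is admissible in `toyData 0`).
[folklore] -/
theorem thetaRegionsAdm_toySettingNE : ThetaRegionsAdm toySettingNE := fun _ _ _ => trivial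

/-- Volume transport holds on the nonempty toy (`q`-region and Θ-regions are `univ`; all log-volumes
agree), uniformly at `m = 0`. [folklore] -/
theorem volumeTransportAt_toySettingNE : VolumeTransportAt toySettingNE 0 := fun _ _ => le_rfl

/-- … hence pointwise. [folklore] -/
theorem volumeTransport_toySettingNE : VolumeTransport toySettingNE :=
  volumeTransport_of_at volumeTransportAt_toySettingNE

/-- The route runs end to end on the toy. [folklore] -/
example : toySettingNE.Statement :=
  statement_of_volumeTransport toySettingNE bridgeHyps_toySettingNE thetaRegionsAdm_toySettingNE
    volumeTransport_toySettingNE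

/-- A link gluing for the toy (all object types are `Unit`). [folklore] -/
def linkGluingToy : LinkGluing toySettingNE := ⟨fun _ => (), rfl⟩

/-- Its two-ways comparison (all regions are `univ`). [folklore] -/
theorem linkGluingToy_twoWays : linkGluingToy.TwoWays := fun _ _ _ => ⟨0, le_rfl⟩

/-- The decomposed route runs end to end on the toy. [folklore] -/
example : toySettingNE.Statement :=
  statement_of_linkGluing toySettingNE bridgeHyps_toySettingNE thetaRegionsAdm_toySettingNE
    linkGluingToy linkGluingToy_twoWays

end Checks

end Cor312Vol

end IUTFork

end Summit.ABC

end
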